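import Summits.AtomisticToContinuum.BoseEinsteinCondensation.Theorems.BoxLatticeFSumShellModeCountingProof
import HarnessLib

/-!
# «ModePurity» — a SECOND-MOMENT carving of DE = `BoxDeepInfraredEmptiness`
# (decomp-a2c · lens-6 «barrier-complement carving» · g32; conjunct `_root_.BoseEinsteinCondensation`)

Statement decomposed (the declared residual of the box line of record, tree
`…Theorems.BoxLatticeFSum.BoxDeepInfraredEmptiness`, DE): Dirichlet near-minimisers put `≤ N/8` particles
into the NONZERO DCT block waves `g_q` with `ε_P(q) < θ`.  g30/g31 carved DE along the ENERGY axis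
(horizon `Θ_E`, NEAR ⟸ LHY-precision local depletion LD, FAR ⟸ coherence COH ∧ witness WIT).  This node
carves DE along a DIFFERENT axis, BY CONSTRUCTION: the SECOND MOMENTS `⟨n̂_q²⟩` of the band occupations.

New quantity: `occupationSq N φ Ψ = ‖n̂_φ Ψ‖² = ⟨Ψ, n̂_φ² Ψ⟩`, the second moment of the number operator
`n̂_φ = Σ_j |φ⟩⟨φ|_j` of a normalised one-body mode `φ` (`modeNumberOp`).  With the band
`D = {q : 0 < ε_P(q) < θ}`, the sub-threshold set `S = {q : ε_P(q) < θ} = {0} ∪ D`, `N_D = Σ_D n(g_q)`,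
`Q_D = Σ_D ⟨n̂_{g_q}²⟩`, `n₀ = n(g_0) = n(constantMode L)`:

* B = `BoxBandSecondMoment` (TAG WEAKER · TRUE-type · leaf ATTACKABLE-NOW, size M–L; the STRUCTURAL
  piece, inside the GP-order energy class): `Q_D ≤ N²/100 + (23/25)·N·N_D` — no branch of a near-minimiser
  puts `≥ 92%` of the particles into ONE nonzero sub-threshold block wave.  Plan (hard cores included —
  every cut is a MULTIPLICATION operator): (i) localise `Ψ = χ_flat Ψ + χ_mod Ψ` in the block-number
  contrast `Σ_B |N̂_B - N/K³|` (a function of the positions: core-compatible, IMS error purely kinetic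
  `O(N⁻¹ℓ⁻²)`), and bound `‖χ_mod Ψ‖² = o(1)` by the GP-order density coercivity of the energy
  (Lieb–Yngvason box superadditivity + convexity of `m ↦ m²`, with the Dyson lemma for hard cores: the
  mechanism of [LY1998] §3–4 / [LSSY2005] Thm 2.x); (ii) the KINEMATIC lemma: for `Φ` supported on
  `μ`-flat block configurations and a block-constant mode `f = Σ_B c_B u_B`,
  `⟨n̂_f²⟩_Φ ≤ (‖c‖₁²/K³ + 3μ + 2/N)·N·⟨n̂_f⟩_Φ` (Cauchy–Schwarz for the form `n̂_f ≥ 0` — `n̂_f` moves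
  one particle, so it raises the contrast by `≤ 2` — and the Gram bound
  `⟨n̂_f⟩_Θ ≤ (Σ_B |c_B| ⟨N̂_B⟩_Θ^{1/2})²` on the `(μ + 2/N)`-flat sector); (iii) for DCT waves with
  `ε_P(q) < 1/128`, `‖c_q‖₁²/K³ ≤ (9/10)^{#{j : q_j ≠ 0}}` (the slack `0.9 → 0.92` absorbs `μ` and the
  flat/modulated cross terms); rougher modes are priced by the shell budget SB (Chebyshev, `η ≤ 1/960`)
  and `n̂ ≤ N`.  Why strictly weaker than the conjunct: superblock-fragmented
  states (no BEC) satisfy B; BEC with `c ≤ 23/25` does not forbid `92%` in a band mode, so BEC ⇏ B either.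
* P = `BoxSubThresholdModePurity` (DECLARED RESIDUAL · TAG UNDECIDED · TRUE-type iff the Bogoliubov
  picture · leaf IDEA-NEEDED): `(Σ_S n(g_q))² ≤ N·n₀ + Q_D + N²/100`.  Since `n̂_0 ≤ N` it is implied by
  the symmetric MODE-PURITY inequality `⟨Σ_S n̂_q⟩² ≤ Σ_S ⟨n̂_q²⟩ + N²/100`, i.e. (Jensen) by PAIRWISE
  CO-OCCUPATION EXCLUSION `Σ_{q ≠ q' ∈ S} ⟨n̂_q n̂_q'⟩ ≤ N²/100`: branch by branch, the sub-threshold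
  particles sit in ONE mode — WHICH mode is not asked.  P ⟸ DE_{1/300} (arithmetic, `n₀ ≤ N`); P is
  STRICTLY WEAKER than DE: a condensate (or a cat of condensates) in NONZERO sub-threshold block waves has
  `S = N, n₀ = 0, Q_D = N²` — P holds, DE and BEC fail; conversely BEC ⇏ P (two co-occupied modes).
  P is FALSE at `a = 0` (sine-profile ground state: `S ≈ N`, `n₀ ≈ 0.53N`, `Q_D ≈ 0.02N²`), so
  `0 < scatteringLength v` is load-bearing, as for DE.  What P still excludes (honest difficulty
  declaration): democratic fragmentation over sub-threshold modes (superblock-Fock / phase-disordered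
  states: `S ≈ N`, `n₀ ≈ N/M`, `Q_D ≈ N²/M`) AND macroscopic two-mode coexistence — i.e. ALL the
  phase-coherence content of DE; B carries the density / which-mode content.  Barrier placement: P has
  DE's quantifier shape (`∃ δ` after `∀ᶠ N`, no spectral gap, no infrared energy resolution, no reflection
  positivity) — outside the hypotheses of the catalogued `KineticGap…` (Temperley / missing spectral gap)
  and `HalfFillingReflectionPositivity…` / `GaussianDomination` entries exactly as DE is; B is an
  energy-method statement at GP order and does not need to beat any of them.
* The INTERFACE is the second moment `Q_D`: eliminating it (P ∧ B ⇒ `S² ≤ N n₀ + 0.92 N N_D + N²/50`)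
  gives flat-mode BEC outright (with `23/25` in place of `0.9`) — so neither piece can be dropped, and the split is not a costume of DE
  (separating families both ways, above).

KERNEL (proved below, no `sorry`): `flatModeDominance_of_purity : BoxMixedFloor → BoxShellBound →
BoxBandSecondMoment → BoxSubThresholdModePurity → FlatModeDominancePos` (MF at `η = 1/200`, shift 0,
DCT Parseval + super-block domination ⇒ `Σ_q n(g_q) ≥ 0.995N`; SB at `η = θ/1200` + Chebyshev ⇒
`Σ_{ε_P ≥ θ} n ≤ N/200`; hence `s = n₀ + N_D ≥ 0.99N`; P and B give `0.08·N·n₀ ≥ s(s - 0.92N) - 0.02N²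
≥ 0.0493N²`, so `n₀ ≥ 0.61N ≥ N/2` — no upper bound on `s` is used) and
`bec_of_purityPieces : BoxMixedFloor → BoxShellBudget → BoxBandSecondMoment → BoxSubThresholdModePurity →
BoseEinsteinCondensation` (`a = 0` by the tree's `zeroScatteringBEC_holds`).

[cite: LSSY2005, §1.2, Thm 2.x, Ch. 5; LY1998 §3–4] (folklore: number-operator second moments, Jensen,
Chebyshev).  Repair census and probes: `NODE-ModePurity.md` next to this file.
-/

noncomputable section

open MeasureTheory Filter Finset
open scoped BigOperators ENNReal NNReal Topology

namespace Summit.AtomisticToContinuum.BoseEinsteinCondensation.Theorems.BoxModePurity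

open Literature.MathematicalPhysics.QuantumManyBody.BoseGas
open Summit.AtomisticToContinuum.BoseEinsteinCondensation.Theses.BlockLatticeFSum
open Summit.AtomisticToContinuum.BoseEinsteinCondensation.Theorems.BlockLatticeFSumDirichletFloor
open Summit.AtomisticToContinuum.BoseEinsteinCondensation.Theorems.BoxLatticeFSum

/-! ## 1. The second moment of a mode occupation -/

/-- The number operator of the (normalised) one-body mode `φ` applied to an `N`-body wave function:
`(n̂_φ Ψ)(X) = Σ_j φ(x_j) · ∫ conj(φ(y)) Ψ(x_1,…,x_{j-1},y,x_{j+1},…,x_N) dy`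
(`n̂_φ = Σ_j |φ⟩⟨φ|_j`).  For symmetric `Ψ`, `⟨Ψ, n̂_φ Ψ⟩ = occupation N φ Ψ`. [folklore] -/
def modeNumberOp {N : ℕ} (φ : Space → ℂ) (Ψ : Config N → ℂ) (X : Config N) : ℂ :=
  ∑ j : Fin N, φ (X j) * ∫ y : Space, (starRingEnd ℂ) (φ y) * Ψ (Function.update X j y)

/-- **Second moment of the occupation of `φ`**: `occupationSq N φ Ψ = ‖n̂_φ Ψ‖² = ⟨Ψ, n̂_φ² Ψ⟩`
(`n̂_φ` is self-adjoint).  Kinematically `occupation² ≤ occupationSq ≤ N · occupation` for normalised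
`Ψ, φ` (`0 ≤ n̂_φ ≤ N`). [folklore] -/
def occupationSq (N : ℕ) (φ : Space → ℂ) (Ψ : Config N → ℂ) : ℝ≥0∞ :=
  ∫⁻ X : Config N, ((‖modeNumberOp φ Ψ X‖₊ : ℝ≥0∞)) ^ 2

/-! ## 2. The two pieces -/

/-- **B = `BoxBandSecondMoment`** (TAG WEAKER · TRUE-type · leaf ATTACKABLE, size M–L; structural piece,
GP-order energy class).  For every repulsive finite-range `v` with positive scattering length, every block
constant `A > 0` and threshold `θ > 0`: below a density cap, eventually in `N`, for some `δ > 0`, every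
Dirichlet `δ`-near-minimiser satisfies, for every even `K > 0` with `L/K` in the window,
`Σ_{0<ε_P(q)<θ} ⟨n̂_{g_q}²⟩ ≤ N²/100 + (23/25)·N·Σ_{0<ε_P(q)<θ} n(g_q)`.
Why it might fail: only if a near-minimiser had a branch with `≥ 0.92N` particles in ONE nonzero smooth
block wave — excluded at GP order: multiplicative localisation in the block-number contrast (core-
compatible) + density coercivity (LY box superadditivity + convexity, Dyson lemma), then the kinematic
second-moment lemma `⟨n̂_f²⟩ ≤ (‖c‖₁²/K³ + 3μ + 2/N)·N·⟨n̂_f⟩` on `μ`-flat sectors (Cauchy–Schwarz for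
the form `n̂_f`, Gram bound), with `‖c_q‖₁²/K³ ≤ (9/10)^{d}` for `ε_P(q) < 1/128`; rougher modes are
priced by the shell budget.  Not the conjunct: superblock-fragmented states satisfy it.
[cite: LSSY2005, Thm 2.x, Thm 5.1; LiebYngvason1998 §3–4] -/
@[conjecture] def BoxBandSecondMoment : Prop :=
  ∀ v : ℝ → ℝ≥0∞, IsRepulsiveFiniteRange v → 0 < scatteringLength v →
    ∀ A : ℝ, 0 < A → ∀ θ : ℝ, 0 < θ →
    ∃ ρ₀ : ℝ, 0 < ρ₀ ∧ ∀ ρ : ℝ, 0 < ρ → ρ < ρ₀ → ∀ᶠ N : ℕ in atTop, ∃ δ : ℝ≥0∞, 0 < δ ∧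
      ∀ Ψ : TrialState N (sideLength ρ N),
        energy v Ψ ≤ groundStateEnergy v N (sideLength ρ N) + δ →
        ∀ K : ℕ, Even K → 0 < K → InWindow A ρ (sideLength ρ N) K →
          (∑ q ∈ (Finset.univ.filter fun q : SubIdx K =>
              0 < pathDispersion K q ∧ pathDispersion K q < θ),
            occupationSq N (boxBlockWave (sideLength ρ N) K q) Ψ.ψ) ≤
          ENNReal.ofReal ((N : ℝ) ^ 2 / 100) + ENNReal.ofReal (23 / 25 * (N : ℝ)) *
            ∑ q ∈ (Finset.univ.filter fun q : SubIdx K =>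
                0 < pathDispersion K q ∧ pathDispersion K q < θ),
              occupation N (boxBlockWave (sideLength ρ N) K q) Ψ.ψ

/-- **P = `BoxSubThresholdModePurity`** (DECLARED RESIDUAL · TAG UNDECIDED · TRUE-type iff the Bogoliubov
picture · leaf IDEA-NEEDED).  For every repulsive finite-range `v` with positive scattering length there
are a block constant `A > 0`, a threshold `θ > 0` and a density cap such that, eventually in `N`, for some
`δ > 0`, every Dirichlet `δ`-near-minimiser satisfies, for every even `K > 0` with `L/K` in the window,
`(Σ_{ε_P(q)<θ} n(g_q))² ≤ N · n(constantMode L) + Σ_{0<ε_P(q)<θ} ⟨n̂_{g_q}²⟩ + N²/100`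
(mode purity with the flat term linearised by `n̂_0 ≤ N`; ⟸ pairwise co-occupation exclusion by Jensen;
⟸ DE_{1/300}).  Why it might fail: democratic fragmentation of near-minimisers over sub-threshold block
waves, or macroscopic two-mode coexistence — the phase-coherence content of DE; FALSE at `a = 0` (sine
profile).  Why strictly weaker than DE / not the conjunct: condensates (and cats of condensates) in NONZERO
sub-threshold block waves satisfy P and violate DE and BEC; BEC ⇏ P.  Outside the KineticGap / RP barrier
hypotheses exactly as DE (same quantifier shape, no gap, no IR energy resolution).
[cite: LSSY2005, §1.2 and Ch. 5] (folklore Bogoliubov heuristics: `N_D, Q_D^{1/2} = O(√(ρa³) + ξ/L)·N`) -/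
@[conjecture] def BoxSubThresholdModePurity : Prop :=
  ∀ v : ℝ → ℝ≥0∞, IsRepulsiveFiniteRange v → 0 < scatteringLength v →
    ∃ A : ℝ, 0 < A ∧ ∃ θ : ℝ, 0 < θ ∧ ∃ ρ₀ : ℝ, 0 < ρ₀ ∧ ∀ ρ : ℝ, 0 < ρ → ρ < ρ₀ →
      ∀ᶠ N : ℕ in atTop, ∃ δ : ℝ≥0∞, 0 < δ ∧ ∀ Ψ : TrialState N (sideLength ρ N),
        energy v Ψ ≤ groundStateEnergy v N (sideLength ρ N) + δ →
        ∀ K : ℕ, Even K → 0 < K → InWindow A ρ (sideLength ρ N) K →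
          (∑ q ∈ (Finset.univ.filter fun q : SubIdx K => pathDispersion K q < θ),
              occupation N (boxBlockWave (sideLength ρ N) K q) Ψ.ψ) ^ 2 ≤
          ENNReal.ofReal (N : ℝ) * occupation N (constantMode (sideLength ρ N)) Ψ.ψ
            + (∑ q ∈ (Finset.univ.filter fun q : SubIdx K =>
                  0 < pathDispersion K q ∧ pathDispersion K q < θ),
                occupationSq N (boxBlockWave (sideLength ρ N) K q) Ψ.ψ)
            + ENNReal.ofReal ((N : ℝ) ^ 2 / 100)

/-! ## 3. Abstract counting: reals, then `ℝ≥0∞` bookkeeping -/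

/-- The real inequality behind the kernel: from `s = x + b ≥ 0.99N`, `s² ≤ N x + Q + N²/100` and
`Q ≤ N²/100 + 0.92·N·b` one gets `0.08·N·x ≥ s(s - 0.92N) - 0.02N² ≥ 0.0493N²`, so `x ≥ 0.61N ≥ N/2`. [folklore] -/
theorem purity_real_core {N x b Q : ℝ} (hN : 0 ≤ N) (hx : 0 ≤ x)
    (hP : 99 / 100 * N ≤ x + b) (hM : (x + b) ^ 2 ≤ N * x + Q + N ^ 2 / 100)
    (hB : Q ≤ N ^ 2 / 100 + 23 / 25 * N * b) : N / 2 ≤ x := by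
  rcases hN.eq_or_lt with h | hNpos
  · rw [← h]; simpa using hx
  · have h1 : 0 ≤ x + b - 99 / 100 * N := by linarith
    have h2 : 0 ≤ x + b - 23 / 25 * N := by linarith
    nlinarith [mul_nonneg h1 h2, mul_nonneg hN h1, mul_pos hNpos hNpos, mul_nonneg hN hx]

/-- **Abstract purity counting** (`ℝ≥0∞` bookkeeping).  Modes `q : ι` with occupations `n q`, a
dispersion `ε`, positive exactly off `q₀`, the band `D = {0 < ε < θ}`, the sub-threshold set
`S = {ε < θ}`, a band second moment `Q`: total mass `≥ (1 - 1/200)N`, budget `Σ ε·n ≤ 6(θ/1200)N`,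
`Q ≤ N²/100 + (23/25)N·Σ_D n` and `(Σ_S n)² ≤ N·n(q₀) + Q + N²/100` give `n(q₀) ≥ N/2`. [folklore] -/
theorem purity_counting_abstract {ι : Type*} [Fintype ι] [DecidableEq ι]
    (n : ι → ℝ≥0∞) (ε : ι → ℝ) (q₀ : ι) (Q : ℝ≥0∞) (D S : Finset ι) {θ N : ℝ}
    (hθ : 0 < θ) (hN : 0 ≤ N) (hε₀ : ∀ q, 0 < ε q ↔ q ≠ q₀)
    (hDm : ∀ q, q ∈ D ↔ 0 < ε q ∧ ε q < θ) (hSm : ∀ q, q ∈ S ↔ ε q < θ)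
    (hP : ENNReal.ofReal ((1 - 1 / 200) * N) ≤ ∑ q, n q)
    (hSB : ∑ q, ENNReal.ofReal (ε q) * n q ≤ ENNReal.ofReal (6 * (θ / 1200) * N))
    (hB : Q ≤ ENNReal.ofReal (N ^ 2 / 100) + ENNReal.ofReal (23 / 25 * N) * ∑ q ∈ D, n q)
    (hM : (∑ q ∈ S, n q) ^ 2 ≤ ENNReal.ofReal N * n q₀ + Q + ENNReal.ofReal (N ^ 2 / 100)) :
    ENNReal.ofReal (N / 2) ≤ n q₀ := by
  classical
  -- (a) Chebyshev on the complement of `S`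
  have hhigh : ∑ q ∈ Finset.univ.filter (fun q => ¬ ε q < θ), n q ≤ ENNReal.ofReal (N / 200) := by
    calc ∑ q ∈ Finset.univ.filter (fun q => ¬ ε q < θ), n q
        ≤ ∑ q ∈ Finset.univ.filter (fun q => ¬ ε q < θ),
            ENNReal.ofReal θ⁻¹ * (ENNReal.ofReal (ε q) * n q) := by
          refine Finset.sum_le_sum fun q hq => ?_
          rw [Finset.mem_filter] at hq
          have hεq : θ ≤ ε q := not_lt.1 hq.2
          calc n q = 1 * n q := (one_mul _).symm
            _ ≤ (ENNReal.ofReal θ⁻¹ * ENNReal.ofReal (ε q)) * n q := by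
                gcongr
                rw [← ENNReal.ofReal_mul (inv_nonneg.2 hθ.le), ← ENNReal.ofReal_one]
                refine ENNReal.ofReal_le_ofReal ?_
                rw [inv_mul_eq_div, le_div_iff₀ hθ, one_mul]
                exact hεq
            _ = _ := by rw [mul_assoc]
      _ = ENNReal.ofReal θ⁻¹ * ∑ q ∈ Finset.univ.filter (fun q => ¬ ε q < θ),
            ENNReal.ofReal (ε q) * n q := by rw [Finset.mul_sum]
      _ ≤ ENNReal.ofReal θ⁻¹ * ∑ q, ENNReal.ofReal (ε q) * n q := by
          gcongr
          exact Finset.subset_univ _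
      _ ≤ ENNReal.ofReal θ⁻¹ * ENNReal.ofReal (6 * (θ / 1200) * N) := by gcongr
      _ = ENNReal.ofReal (N / 200) := by
          rw [← ENNReal.ofReal_mul (inv_nonneg.2 hθ.le)]
          congr 1
          field_simp
          ring
  -- (b) `S` as a filter, and `univ = S ⊔ Sᶜ`
  have hSS : S = Finset.univ.filter (fun q => ε q < θ) := by
    ext q
    simp [hSm q]
  have hsplit : ∑ q, n q = ∑ q ∈ S, n q + ∑ q ∈ Finset.univ.filter (fun q => ¬ ε q < θ), n q := by
    rw [hSS]
    exact (Finset.sum_filter_add_sum_filter_not Finset.univ (fun q => ε q < θ) n).symm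
  have hSlow : ENNReal.ofReal (99 / 100 * N) ≤ ∑ q ∈ S, n q := by
    have hle : ENNReal.ofReal ((1 - 1 / 200) * N) ≤ ∑ q ∈ S, n q + ENNReal.ofReal (N / 200) := by
      calc ENNReal.ofReal ((1 - 1 / 200) * N) ≤ ∑ q, n q := hP
        _ = _ := hsplit
        _ ≤ _ := add_le_add le_rfl hhigh
    have hsub := tsub_le_iff_right.2 hle
    calc ENNReal.ofReal (99 / 100 * N) = ENNReal.ofReal ((1 - 1 / 200) * N - N / 200) := by
          congr 1; ring
      _ = ENNReal.ofReal ((1 - 1 / 200) * N) - ENNReal.ofReal (N / 200) :=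
          ENNReal.ofReal_sub _ (by positivity)
      _ ≤ ∑ q ∈ S, n q := hsub
  -- (c) `Σ_S = n q₀ + Σ_D`
  have hq₀S : q₀ ∈ S := by
    rw [hSm]
    have h0 : ¬ 0 < ε q₀ := fun h => ((hε₀ q₀).1 h) rfl
    linarith [not_lt.1 h0]
  have hDS : D = S.erase q₀ := by
    ext q
    rw [hDm, Finset.mem_erase, hSm, hε₀]
  have hSsum : ∑ q ∈ S, n q = n q₀ + ∑ q ∈ D, n q := by
    rw [hDS, Finset.add_sum_erase S n hq₀S]
  -- (d) finiteness of the band mass and of `Q`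
  have hbudget_fin : ∑ q, ENNReal.ofReal (ε q) * n q ≠ ⊤ :=
    ne_top_of_le_ne_top ENNReal.ofReal_ne_top hSB
  have hnD_fin : ∀ q ∈ D, n q ≠ ⊤ := by
    intro q hq
    have hεq : 0 < ε q := ((hDm q).1 hq).1
    have hterm : ENNReal.ofReal (ε q) * n q ≠ ⊤ := by
      refine ne_top_of_le_ne_top hbudget_fin ?_
      exact Finset.single_le_sum (f := fun q => ENNReal.ofReal (ε q) * n q)
        (fun _ _ => zero_le) (Finset.mem_univ q)
    exact (ENNReal.lt_top_of_mul_ne_top_right hterm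
      (by rwa [Ne, ENNReal.ofReal_eq_zero, not_le])).ne
  have hD_fin : ∑ q ∈ D, n q ≠ ⊤ := ENNReal.sum_ne_top.2 hnD_fin
  have hBrhs_fin : ENNReal.ofReal (N ^ 2 / 100) + ENNReal.ofReal (23 / 25 * N) * ∑ q ∈ D, n q ≠ ⊤ :=
    ENNReal.add_ne_top.2 ⟨ENNReal.ofReal_ne_top, ENNReal.mul_ne_top ENNReal.ofReal_ne_top hD_fin⟩
  have hQ_fin : Q ≠ ⊤ := ne_top_of_le_ne_top hBrhs_fin hB
  -- (e) the flat mode: infinite occupation is fine, else pass to reals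
  by_cases hq₀top : n q₀ = ⊤
  · rw [hq₀top]; exact le_top
  have hS_fin : ∑ q ∈ S, n q ≠ ⊤ := by
    rw [hSsum]; exact ENNReal.add_ne_top.2 ⟨hq₀top, hD_fin⟩
  have hMrhs_fin : ENNReal.ofReal N * n q₀ + Q + ENNReal.ofReal (N ^ 2 / 100) ≠ ⊤ :=
    ENNReal.add_ne_top.2 ⟨ENNReal.add_ne_top.2
      ⟨ENNReal.mul_ne_top ENNReal.ofReal_ne_top hq₀top, hQ_fin⟩, ENNReal.ofReal_ne_top⟩
  set x : ℝ := (n q₀).toReal with hxdef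
  set b : ℝ := (∑ q ∈ D, n q).toReal with hbdef
  set Qr : ℝ := Q.toReal with hQrdef
  have hx0 : 0 ≤ x := ENNReal.toReal_nonneg
  have hSreal : (∑ q ∈ S, n q).toReal = x + b := by
    rw [hSsum, ENNReal.toReal_add hq₀top hD_fin]
  -- the three inequalities in `ℝ`
  have hPr : 99 / 100 * N ≤ x + b := by
    have := ENNReal.toReal_mono hS_fin hSlow
    rwa [ENNReal.toReal_ofReal (by positivity), hSreal] at this
  have hMr : (x + b) ^ 2 ≤ N * x + Qr + N ^ 2 / 100 := by
    have := ENNReal.toReal_mono hMrhs_fin hM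
    rwa [ENNReal.toReal_pow, hSreal, ENNReal.toReal_add (ENNReal.add_ne_top.2
        ⟨ENNReal.mul_ne_top ENNReal.ofReal_ne_top hq₀top, hQ_fin⟩) ENNReal.ofReal_ne_top,
      ENNReal.toReal_add (ENNReal.mul_ne_top ENNReal.ofReal_ne_top hq₀top) hQ_fin,
      ENNReal.toReal_mul, ENNReal.toReal_ofReal hN, ENNReal.toReal_ofReal (by positivity)] at this
  have hBr : Qr ≤ N ^ 2 / 100 + 23 / 25 * N * b := by
    have := ENNReal.toReal_mono hBrhs_fin hB
    rwa [ENNReal.toReal_add ENNReal.ofReal_ne_top (ENNReal.mul_ne_top ENNReal.ofReal_ne_top hD_fin),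
      ENNReal.toReal_mul, ENNReal.toReal_ofReal (by positivity),
      ENNReal.toReal_ofReal (by positivity)] at this
  have hreal : N / 2 ≤ x := purity_real_core hN hx0 hPr hMr hBr
  exact (ENNReal.ofReal_le_iff_le_toReal hq₀top).2 hreal

/-! ## 4. The kernels -/

/-- **MF ∧ SB-bound ∧ B ∧ P ⇒ flat-mode dominance** (`c = 1/2`) for positive scattering length.
DCT Parseval + super-block domination turn MF (shift `0`, `η = 1/200`) into `Σ_q n(g_q) ≥ 0.995N`; the
shell bound at `η = θ/1200` and Chebyshev empty the shell `ε_P ≥ θ` down to `N/200`; the abstract purity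
counting concludes. [folklore] -/
theorem flatModeDominance_of_purity (hMF : BoxMixedFloor) (hSB : BoxShellBound)
    (hBB : BoxBandSecondMoment) (hMP : BoxSubThresholdModePurity) : FlatModeDominancePos := by
  intro v hv ha
  obtain ⟨A, hA, θ, hθ, ρP, hρP, HMP⟩ := hMP v hv ha
  obtain ⟨ρB, hρB, HBB⟩ := hBB v hv ha A hA θ hθ
  obtain ⟨ρS, hρS, HSB⟩ := hSB v hv A hA (θ / 1200) (by positivity)
  obtain ⟨ρM, hρM, HMF⟩ := hMF v hv A hA (1 / 200) (by norm_num)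
  refine ⟨min (min ρP ρB) (min ρS ρM), lt_min (lt_min hρP hρB) (lt_min hρS hρM), fun ρ hρ hρlt => ?_⟩
  have hρ1 : ρ < ρP := lt_of_lt_of_le hρlt ((min_le_left _ _).trans (min_le_left _ _))
  have hρ2 : ρ < ρB := lt_of_lt_of_le hρlt ((min_le_left _ _).trans (min_le_right _ _))
  have hρ3 : ρ < ρS := lt_of_lt_of_le hρlt ((min_le_right _ _).trans (min_le_left _ _))
  have hρ4 : ρ < ρM := lt_of_lt_of_le hρlt ((min_le_right _ _).trans (min_le_right _ _))
  refine ⟨1 / 2, by norm_num, ?_⟩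
  have hsρ : 0 < Real.sqrt ρ := Real.sqrt_pos.2 hρ
  have hN2 : ∀ᶠ N : ℕ in atTop, ρ * (2 * A / Real.sqrt ρ) ^ 3 ≤ (N : ℝ) :=
    tendsto_natCast_atTop_atTop.eventually_ge_atTop _
  filter_upwards [HMP ρ hρ hρ1, HBB ρ hρ hρ2, HSB ρ hρ hρ3, HMF ρ hρ hρ4, hN2, eventually_ge_atTop 1]
    with N hN1 hN2' hN3 hN4 hNbig hNone
  obtain ⟨δ₁, hδ₁, hΨ₁⟩ := hN1
  obtain ⟨δ₂, hδ₂, hΨ₂⟩ := hN2'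
  obtain ⟨δ₃, hδ₃, hΨ₃⟩ := hN3
  obtain ⟨δ₄, hδ₄, hΨ₄⟩ := hN4
  have hNpos : 0 < N := hNone
  obtain ⟨n, rfl⟩ : ∃ n, N = n + 1 := ⟨N - 1, by omega⟩
  have hNr : (0 : ℝ) < ((n + 1 : ℕ) : ℝ) := by exact_mod_cast hNpos
  set L : ℝ := sideLength ρ (n + 1) with hLdef
  have hL : 0 < L := Real.rpow_pos_of_pos (div_pos hNr hρ) _
  have hL3 : L ^ 3 = (((n + 1 : ℕ) : ℝ)) / ρ := sideLength_pow_three hρ (n + 1)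
  refine ⟨min (min δ₁ δ₂) (min δ₃ δ₄), lt_min (lt_min hδ₁ hδ₂) (lt_min hδ₃ hδ₄), fun Ψ hE => ?_⟩
  have hE1 : energy v Ψ ≤ groundStateEnergy v (n + 1) L + δ₁ :=
    hE.trans (add_le_add le_rfl ((min_le_left _ _).trans (min_le_left _ _)))
  have hE2 : energy v Ψ ≤ groundStateEnergy v (n + 1) L + δ₂ :=
    hE.trans (add_le_add le_rfl ((min_le_left _ _).trans (min_le_right _ _)))
  have hE3 : energy v Ψ ≤ groundStateEnergy v (n + 1) L + δ₃ :=
    hE.trans (add_le_add le_rfl ((min_le_right _ _).trans (min_le_left _ _)))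
  have hE4 : energy v Ψ ≤ groundStateEnergy v (n + 1) L + δ₄ :=
    hE.trans (add_le_add le_rfl ((min_le_right _ _).trans (min_le_right _ _)))
  -- the side is long enough: `L√ρ ≥ 2A`
  have hLbig : 2 * A ≤ L * Real.sqrt ρ := by
    have hY : 0 < 2 * A / Real.sqrt ρ := by positivity
    have hLY : 2 * A / Real.sqrt ρ ≤ L := by
      by_contra hcon
      have hlt : L < 2 * A / Real.sqrt ρ := not_le.1 hcon
      have h3 : L ^ 3 < (2 * A / Real.sqrt ρ) ^ 3 := pow_lt_pow_left₀ hlt hL.le three_ne_zero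
      have : (((n + 1 : ℕ) : ℝ)) < ρ * (2 * A / Real.sqrt ρ) ^ 3 := by
        rw [hL3] at h3
        rwa [div_lt_iff₀ hρ, mul_comm] at h3
      linarith
    have := (div_le_iff₀ hsρ).1 hLY
    linarith
  -- an even `K` in the window
  obtain ⟨K, hKeven, hKpos, hwin⟩ := exists_even_inWindow hA hρ hLbig
  -- the four inputs at this `K`
  have hP' := hΨ₁ Ψ hE1 K hKeven hKpos hwin
  have hB' := hΨ₂ Ψ hE2 K hKeven hKpos hwin
  have hS' := hΨ₃ Ψ hE3 K hKeven hKpos hwin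
  have hM' := hΨ₄ Ψ hE4 K hKeven hKpos hwin (fun _ => (⟨0, two_pos⟩ : Fin 2))
  -- Parseval and super-block domination, in `occupation` currency
  have hPar := parseval_boxBlockWaves_trialState hNpos hKpos hL Ψ
  have hMF' : ENNReal.ofReal ((1 - 1 / 200) * ((n + 1 : ℕ) : ℝ)) ≤
      ∑ q : SubIdx K, occupation (n + 1) (boxBlockWave L K q) Ψ.ψ := by
    rw [hPar]
    refine hM'.trans ?_
    simp_rw [pieceMode_zero_shift, occupation_trialState_eq_cellOccupation Ψ]
    exact sum_cellOccupation_superBlock_le hKpos hL Ψ.contDiff.continuous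
  -- the flat term of P in block-wave currency
  rw [← occupation_boxBlockWave_of_coords_zero hKpos hL (q := fun _ => (⟨0, hKpos⟩ : Fin K))
      (fun _ => rfl) Ψ.ψ] at hP'
  -- counting
  classical
  have hcount := purity_counting_abstract
    (fun q : SubIdx K => occupation (n + 1) (boxBlockWave L K q) Ψ.ψ)
    (fun q : SubIdx K => pathDispersion K q)
    (fun _ => (⟨0, hKpos⟩ : Fin K))
    (∑ q ∈ (Finset.univ.filter fun q : SubIdx K => 0 < pathDispersion K q ∧ pathDispersion K q < θ),
        occupationSq (n + 1) (boxBlockWave L K q) Ψ.ψ)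
    ((Finset.univ : Finset (SubIdx K)).filter fun q => 0 < pathDispersion K q ∧ pathDispersion K q < θ)
    ((Finset.univ : Finset (SubIdx K)).filter fun q => pathDispersion K q < θ)
    hθ hNr.le (pathDispersion_pos_iff hKpos)
    (fun q => by simp) (fun q => by simp) hMF' hS' hB' hP'
  rw [occupation_boxBlockWave_of_coords_zero hKpos hL (q := fun _ => (⟨0, hKpos⟩ : Fin K))
      (fun _ => rfl)] at hcount
  have hc : (1 / 2 : ℝ) * ((n + 1 : ℕ) : ℝ) = ((n + 1 : ℕ) : ℝ) / 2 := by ring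
  rw [hc]
  exact hcount

/-- **The node's assembly**: MF ∧ SB ∧ B ∧ P ⇒ `BoseEinsteinCondensation` (the `a = 0` branch by the
tree's `zeroScatteringBEC_holds`; SB = `BoxShellBudget : BoxMixedFloor → BoxShellBound` is the tree's
kinematic support item). [folklore] -/
theorem bec_of_purityPieces (hMF : BoxMixedFloor) (hSB : BoxShellBudget)
    (hBB : BoxBandSecondMoment) (hMP : BoxSubThresholdModePurity) :
    _root_.BoseEinsteinCondensation := by
  intro v hv
  rcases eq_or_ne (scatteringLength v) 0 with h0 | h0
  · exact zeroScatteringBEC_holds v hv h0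
  · exact bec_pos_of_flatModeDominance (flatModeDominance_of_purity hMF (hSB hMF) hBB hMP) v hv
      (pos_iff_ne_zero.mpr h0)

/-- The same assembly routed through the box line's kernel shape: B ∧ P REPLACE DE ∧ MC in
`bec_of_boxPieces` (MC's role is played by `flatModeDominance_of_purity`). [folklore] -/
theorem flatModeDominancePos_iff_of_pieces (hMF : BoxMixedFloor) (hSB : BoxShellBudget)
    (hBB : BoxBandSecondMoment) (hMP : BoxSubThresholdModePurity) : FlatModeDominancePos :=
  flatModeDominance_of_purity hMF (hSB hMF) hBB hMP

end Summit.AtomisticToContinuum.BoseEinsteinCondensation.Theorems.BoxModePurity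

end
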